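import Summits.Ventures.PercRepro.ProfileGapMonoThresholdParallelClass

/-!
# PercRepro — THE CHARGING OF THE WEAK AVERAGED STEP AT `(2, 3)` ON A LOOPLESS MATROID: the up-sets of a
rank-`1` set and their weights (p5, gen 27; `proofs/P5-GM1.md` §27)

For a rank-`1` set `B` (class `P = clF N B`) and a point `y ∉ P`, the UP-SET `insert y B` is a rank-`2` set of
co-rank `≥ ρ(E∖B) − 1`; its weight in the supply `2 Σ_{S ∈ T_3} #S + 2 Σ_{S ∈ T_3, ρ(E∖S) = 3} κ(E∖S)` is
`2 · h(S)`, `h(S) := #S + [ρ(E∖S) = 3] κ(E∖S)`.  The SHARE of `B` in its up-set is `h(S)` when `B` is a singleton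
whose partner `{y}` is itself a demanding set (`ρ(E∖y) ≥ 4`: the pair has two claimants) and `2 h(S)` otherwise
(one claimant).  This file proves the two facts about the up-sets that every per-set bound of §27 uses:
* `coloops_erase_subset_coloops_erase` — the other coloops of `X` are coloops of `X ∖ y` (submodularity);
* `insert_mem_levelSetCoQ_of_rankOne` — the up-set lies in `T_3` when `ρ(E∖B) ≥ 4`;
and the VALIDITY of the shares: summed over the demanding sets, they never exceed the supply
(`sum_share_le_sum_weight`): an up-set `S` has at most two claimants, and two claimants force `S = {b, y}` with
`B = {b}`, `{y}` both demanding, where each claims the half `h(S)`.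
-/

open scoped Matroid

namespace PercRepro.Cogirth

open Finset ThmH Skew Shadow Profile

variable {α : Type} [DecidableEq α] {M : Matroid α} [M.Finite]

section UpSets

/-- `E ∖ insert y B = (E ∖ B) ∖ y`. -/
theorem sdiff_insert_eq_erase (B : Finset α) (y : α) : gr M \ insert y B = (gr M \ B).erase y := by
  ext x
  simp only [mem_sdiff, mem_insert, mem_erase, not_or]
  tauto

/-- **The other coloops survive**: for a coloop `y` of `X`, every other coloop of `X` is a coloop of `X ∖ y`
(`ρ(X∖y) + ρ(X∖w) ≥ ρ(X) + ρ(X∖{y,w})`). -/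
theorem coloops_erase_subset_coloops_erase {X : Finset α} (hX : X ⊆ gr M) {y : α}
    (hy : y ∈ coloops M X) : (coloops M X).erase y ⊆ coloops M (X.erase y) := by
  intro w hw
  rw [mem_erase] at hw
  obtain ⟨hwy, hw⟩ := hw
  have hwX : w ∈ X := coloops_subset X hw
  have hry : rk M (X.erase y) + 1 = rk M X := rk_erase_of_mem_coloops hX hy
  have hrw : rk M (X.erase w) + 1 = rk M X := rk_erase_of_mem_coloops hX hw
  have hwXy : w ∈ X.erase y := mem_erase.2 ⟨hwy, hwX⟩
  apply mem_coloops_of_rk_erase ((erase_subset _ _).trans hX) hwXy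
  have hU : X.erase y ∪ X.erase w = X := by
    ext x
    simp only [mem_union, mem_erase]
    constructor
    · rintro (⟨_, h⟩ | ⟨_, h⟩) <;> exact h
    · intro hx
      by_cases hxy : x = y
      · exact Or.inr ⟨by rw [hxy]; exact fun h => hwy h.symm, hx⟩
      · exact Or.inl ⟨hxy, hx⟩
  have hI : X.erase y ∩ X.erase w = (X.erase y).erase w := by
    ext x
    simp only [mem_inter, mem_erase]
    tauto
  have hsub := rk_union_add_rk_inter_le (M := M) (X.erase y) (X.erase w)
  rw [hU, hI] at hsub
  have hlo := rk_le_rk_erase_add_one (M := M) (X := X.erase y) ((erase_subset _ _).trans hX) hwXy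
  omega

variable {N : Matroid α} [N.Finite]

/-- A point outside the class raises the rank of a rank-`1` set to `2`. -/
theorem rk_insert_eq_two_of_notMem_clF {B : Finset α} (hB : B ∈ Rq N 1) {y : α}
    (hy : y ∈ gr N \ clF N B) : rk N (insert y B) = 2 := by
  rw [mem_Rq] at hB
  rw [mem_sdiff] at hy
  have h1 : rk N B = 1 := rk_eq_of_eRk_eq_cq hB.2
  have h := rk_insert_eq hy.1 hB.1
  rw [if_neg hy.2, h1] at h
  exact h

/-- A point outside the class is outside the set. -/
theorem notMem_of_mem_sdiff_clF {B : Finset α} (hB : B ⊆ gr N) {y : α} (hy : y ∈ gr N \ clF N B) :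
    y ∉ B := fun h => (mem_sdiff.1 hy).2 (subset_clF hB h)

/-- **The up-set is a demanding rank-`2` set**: `insert y B ∈ T_3` when `ρ(E∖B) ≥ 4` and `y ∉ clF N B`. -/
theorem insert_mem_levelSetCoQ_of_rankOne {B : Finset α} (hB : B ∈ Rq N 1) (h4 : 4 ≤ rk N (gr N \ B))
    {y : α} (hy : y ∈ gr N \ clF N B) : insert y B ∈ levelSetCoQ N 3 2 := by
  have hBg : B ⊆ gr N := (mem_Rq.1 hB).1
  have hyg : y ∈ gr N := (mem_sdiff.1 hy).1
  have hyB : y ∉ B := notMem_of_mem_sdiff_clF hBg hy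
  rw [mem_levelSetCoQ]
  refine ⟨⟨insert_subset hyg hBg, eRk_eq_of_rk_eq_cq (rk_insert_eq_two_of_notMem_clF hB hy)⟩, ?_⟩
  rw [sdiff_insert_eq_erase]
  have hyX : y ∈ gr N \ B := mem_sdiff.2 ⟨hyg, hyB⟩
  have := rk_le_rk_erase_add_one (M := N) (X := gr N \ B) sdiff_subset hyX
  omega

end UpSets

section Validity

variable {N : Matroid α} [N.Finite]

/-- **Two claimants of one up-set**: if `(B₀, y₀) ≠ (B₁, y₁)` are two pairs (rank-`1` sets with a point outside
their class) with the same up-set `insert y₀ B₀ = insert y₁ B₁`, then `B₀ = {y₁}` (and symmetrically). -/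
theorem eq_singleton_of_insert_eq (hloop : ∀ x ∈ gr N, rk N {x} = 1) {B₀ B₁ : Finset α} {y₀ y₁ : α}
    (hB₀ : B₀ ∈ Rq N 1) (hB₁ : B₁ ∈ Rq N 1) (hy₀ : y₀ ∈ gr N \ clF N B₀) (hy₁ : y₁ ∈ gr N \ clF N B₁)
    (heq : insert y₀ B₀ = insert y₁ B₁) (hne : ¬ (B₀ = B₁ ∧ y₀ = y₁)) : B₀ = {y₁} := by
  have hB₀g : B₀ ⊆ gr N := (mem_Rq.1 hB₀).1
  have hB₁g : B₁ ⊆ gr N := (mem_Rq.1 hB₁).1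
  have hr₁ : rk N B₁ = 1 := rk_eq_of_eRk_eq_cq (mem_Rq.1 hB₁).2
  have hy₀B : y₀ ∉ B₀ := notMem_of_mem_sdiff_clF hB₀g hy₀
  have hy₁B : y₁ ∉ B₁ := notMem_of_mem_sdiff_clF hB₁g hy₁
  have hyy : y₀ ≠ y₁ := by
    intro h
    subst h
    apply hne
    refine ⟨?_, rfl⟩
    rw [← erase_insert hy₀B, ← erase_insert hy₁B, heq]
  have hy₁B₀ : y₁ ∈ B₀ := by
    have : y₁ ∈ insert y₀ B₀ := by rw [heq]; exact mem_insert_self _ _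
    rw [mem_insert] at this
    rcases this with h | h
    · exact absurd h.symm hyy
    · exact h
  have hy₀B₁ : y₀ ∈ B₁ := by
    have : y₀ ∈ insert y₁ B₁ := by rw [← heq]; exact mem_insert_self _ _
    rw [mem_insert] at this
    rcases this with h | h
    · exact absurd h hyy
    · exact h
  -- every point of `B₀` is `y₁`
  have hsub : B₀ ⊆ {y₁} := by
    intro x hx
    rw [mem_singleton]
    by_contra hxy
    have hxB₁ : x ∈ B₁ := by
      have : x ∈ insert y₁ B₁ := by rw [← heq]; exact mem_insert_of_mem hx
      rw [mem_insert] at this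
      rcases this with h | h
      · exact absurd h hxy
      · exact h
    -- `{y₀, x} ⊆ B₁` has rank `1`, so `y₀ ∈ clF {x} ⊆ clF B₀`
    have hxg : x ∈ gr N := hB₀g hx
    have hy₀g : y₀ ∈ gr N := hB₁g hy₀B₁
    have hpair : rk N (insert y₀ {x}) = 1 :=
      rk_eq_one_of_subset_clF hloop hr₁
        ((insert_subset hy₀B₁ (singleton_subset_iff.2 hxB₁)).trans (subset_clF hB₁g))
        ⟨y₀, mem_insert_self _ _⟩
    have hcl : y₀ ∈ clF N {x} := by
      rw [mem_clF_iff_rk_insert hy₀g (singleton_subset_iff.2 hxg), hpair, hloop x hxg]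
    exact (mem_sdiff.1 hy₀).2 (clF_mono (singleton_subset_iff.2 hx) hcl)
  exact Subset.antisymm hsub (singleton_subset_iff.2 hy₁B₀)

/-- **The multiplicities of one up-set sum to at most `2`**: over the pairs `(B, y)` with `B` demanding and
`insert y B = S`, `Σ (if #B = 1 ∧ 4 ≤ ρ(E∖y) then 1 else 2) ≤ 2`. -/
theorem sum_mult_fibre_le_two (hloop : ∀ x ∈ gr N, rk N {x} = 1) (S : Finset α) :
    ∑ p ∈ (((Rq N 1).filter (fun B => 4 ≤ rk N (gr N \ B))).sigma (fun B => gr N \ clF N B)).filter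
        (fun p : (Σ _ : Finset α, α) => insert p.2 p.1 = S),
      (if p.1.card = 1 ∧ 4 ≤ rk N (gr N \ {p.2}) then 1 else 2) ≤ 2 := by
  set F := (((Rq N 1).filter (fun B => 4 ≤ rk N (gr N \ B))).sigma (fun B => gr N \ clF N B)).filter
    (fun p : (Σ _ : Finset α, α) => insert p.2 p.1 = S) with hF
  -- membership in `F`, unpacked
  have hmem : ∀ p ∈ F, p.1 ∈ Rq N 1 ∧ 4 ≤ rk N (gr N \ p.1) ∧ p.2 ∈ gr N \ clF N p.1 ∧
      insert p.2 p.1 = S := by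
    intro p hp
    rw [hF, mem_filter, mem_sigma, mem_filter] at hp
    exact ⟨hp.1.1.1, hp.1.1.2, hp.1.2, hp.2⟩
  by_cases hcard : F.card ≤ 1
  · calc ∑ p ∈ F, (if p.1.card = 1 ∧ 4 ≤ rk N (gr N \ {p.2}) then 1 else 2)
        ≤ ∑ _p ∈ F, 2 := sum_le_sum (fun p _ => by split_ifs <;> omega)
      _ = F.card * 2 := by rw [sum_const, smul_eq_mul]
      _ ≤ 2 := by omega
  · push Not at hcard
    -- every pair of `F` is a singleton with a demanding partner: multiplicity `1`
    have hone : ∀ p ∈ F, (if p.1.card = 1 ∧ 4 ≤ rk N (gr N \ {p.2}) then 1 else 2) = 1 := by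
      intro p hp
      obtain ⟨p', hp', hne⟩ := exists_mem_ne hcard p
      obtain ⟨hB, _, hy, hS⟩ := hmem p hp
      obtain ⟨hB', h4', hy', hS'⟩ := hmem p' hp'
      have hne' : ¬ (p.1 = p'.1 ∧ p.2 = p'.2) := by
        rintro ⟨h1, h2⟩
        apply hne
        exact (Sigma.ext h1 (heq_of_eq h2)).symm
      have hsing : p.1 = {p'.2} :=
        eq_singleton_of_insert_eq hloop hB hB' hy hy' (hS.trans hS'.symm) hne'
      have hsing' : p'.1 = {p.2} :=
        eq_singleton_of_insert_eq hloop hB' hB hy' hy (hS'.trans hS.symm)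
          (fun h => hne' ⟨h.1.symm, h.2.symm⟩)
      rw [if_pos ⟨by rw [hsing, card_singleton], by rw [← hsing']; exact h4'⟩]
    rw [sum_congr rfl hone, sum_const, smul_eq_mul, mul_one]
    -- `F` injects into `S`, which has two elements
    obtain ⟨p₀, hp₀⟩ : F.Nonempty := by
      rw [← card_pos]; omega
    obtain ⟨p₁, hp₁, hne₁⟩ := exists_mem_ne hcard p₀
    obtain ⟨hB₀, _, hy₀, hS₀⟩ := hmem p₀ hp₀
    obtain ⟨hB₁, _, hy₁, hS₁⟩ := hmem p₁ hp₁
    have hsing₀ : p₀.1 = {p₁.2} :=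
      eq_singleton_of_insert_eq hloop hB₀ hB₁ hy₀ hy₁ (hS₀.trans hS₁.symm)
        (by rintro ⟨h1, h2⟩; exact hne₁ (Sigma.ext h1 (heq_of_eq h2)).symm)
    have hScard : S.card ≤ 2 := by
      rw [← hS₀, hsing₀]
      have h := card_insert_le p₀.2 ({p₁.2} : Finset α)
      rw [card_singleton] at h
      exact h
    refine le_trans (card_le_card_of_injOn (fun p : (Σ _ : Finset α, α) => p.2) ?_ ?_) hScard
    · intro p hp
      rw [mem_coe] at hp
      rw [mem_coe, ← (hmem p hp).2.2.2]
      exact mem_insert_self _ _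
    · rintro ⟨B₁, y₁⟩ hp₁ ⟨B₂, y₂⟩ hp₂ heq
      simp only at heq
      subst heq
      rw [mem_coe] at hp₁ hp₂
      obtain ⟨hB₁', _, hy₁', hS₁'⟩ := hmem _ hp₁
      obtain ⟨hB₂', _, hy₂', hS₂'⟩ := hmem _ hp₂
      have hy₁B : y₁ ∉ B₁ := notMem_of_mem_sdiff_clF (mem_Rq.1 hB₁').1 hy₁'
      have hy₂B : y₁ ∉ B₂ := notMem_of_mem_sdiff_clF (mem_Rq.1 hB₂').1 hy₂'
      have hB : B₁ = B₂ := by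
        simp only at hS₁' hS₂'
        rw [← erase_insert hy₁B, ← erase_insert hy₂B, hS₁', hS₂']
      subst hB
      rfl

/-- **Validity of the shares**: summed over the demanding rank-`1` sets, the shares of the up-sets never exceed
the supply `Σ_{S ∈ T_3} 2 · h(S)`, `h(S) = #S + [ρ(E∖S) = 3] κ(E∖S)`. -/
theorem sum_share_le_sum_weight (hloop : ∀ x ∈ gr N, rk N {x} = 1) :
    ∑ B ∈ (Rq N 1).filter (fun B => 4 ≤ rk N (gr N \ B)), ∑ y ∈ gr N \ clF N B,
        (if B.card = 1 ∧ 4 ≤ rk N (gr N \ {y}) then 1 else 2) *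
          ((insert y B).card +
            (if rk N (gr N \ insert y B) = 3 then (coloops N (gr N \ insert y B)).card else 0)) ≤
      ∑ S ∈ levelSetCoQ N 3 2,
        2 * (S.card + (if rk N (gr N \ S) = 3 then (coloops N (gr N \ S)).card else 0)) := by
  set L := (Rq N 1).filter (fun B => 4 ≤ rk N (gr N \ B)) with hL
  set Q := L.sigma (fun B => gr N \ clF N B) with hQ
  rw [← sum_sigma L (fun B => gr N \ clF N B)
    (fun p => (if p.1.card = 1 ∧ 4 ≤ rk N (gr N \ {p.2}) then 1 else 2) *
      ((insert p.2 p.1).card +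
        (if rk N (gr N \ insert p.2 p.1) = 3 then (coloops N (gr N \ insert p.2 p.1)).card else 0)))]
  have hmaps : ∀ p ∈ Q, insert p.2 p.1 ∈ levelSetCoQ N 3 2 := by
    rintro ⟨B, y⟩ hp
    rw [hQ, mem_sigma, hL, mem_filter] at hp
    exact insert_mem_levelSetCoQ_of_rankOne hp.1.1 hp.1.2 hp.2
  rw [← sum_fiberwise_of_maps_to hmaps]
  apply sum_le_sum
  intro S _
  -- on the fibre of `S` the weight factor is constant: `h(S)`
  rw [sum_congr rfl (fun p hp => by rw [(mem_filter.1 hp).2]), ← sum_mul]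
  apply Nat.mul_le_mul_right
  exact sum_mult_fibre_le_two hloop S

end Validity

end PercRepro.Cogirth
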